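import Mathlib.Analysis.SpecialFunctions.Complex.CircleAddChar
import Mathlib.NumberTheory.LegendreSymbol.AddCharacter
import Literature.MathematicalPhysics.QuantumLattice.XYOrderProofs
import Literature.MathematicalPhysics.QuantumLattice.FinDimSpectrumProofs
import Literature.MathematicalPhysics.QuantumLattice.SpinOperatorsProofs
import Literature.MathematicalPhysics.QuantumLattice.ProductOperators
import Literature.MathematicalPhysics.QuantumLattice.SpinSystemProofs
import HarnessLib

/-!
# Kennedy–Lieb–Shastry, XY model: discharges of the finite-dimensional facts (S), (T), (C), (D), (B)

Trunk T-QLATTICE; sibling proof file of `XYOrderProofs.lean` (item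
`provefact-Literature.Hubbard.kennedy_lieb_shastry_xy_ground`). No statement is introduced or changed;
this file discharges

* `xy_groundCorr_two_eq_one_holds : xy_groundCorr_two_eq_one` — fact (S),
  `⟨S²_x S²_y⟩ = ⟨S¹_x S¹_y⟩`
  in the tracial ground state of the XY torus: the global quarter turn about the `3`-axis
  `U = ⨂_x diag((-i)^k)` maps `Sˣ ↦ -Sʸ`, `Sʸ ↦ Sˣ` (`spinPhase_conj_spinX/Y`), fixes every bond
  term `SˣSˣ + SʸSʸ` of `xyTorus`, hence commutes with it, and the tracial ground-state functional
  is invariant under symmetries (`groundStateFunctional_conj_of_commute`);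
* `xyGroundCorr_abs_le_holds : xyGroundCorr_abs_le` — fact (T), `|⟨Sᵅ_x Sᵅ_y⟩| ≤ S²`: from the
  Loewner bounds `S·1 ± Sᵅ ≥ 0`, `(Sᵅ)² ≤ S²` (`SpinOperatorsProofs`), positivity of `onSite`
  and of products of commuting positive matrices (Mathlib `Commute.mul_nonneg` in the C⋆-order
  of matrices), and positivity/normalisation of the tracial ground state;
* `xy_structureFactor_sumRule_holds : xy_structureFactor_sumRule` — fact (C), the finite-volume
  sum rule `|Λ|⁻¹ Σ_q ĝ^α_q (d⁻¹ Σᵢ cos qᵢ) = e_α` (Kennedy–Lieb–Shastry 1988, eqs. (3), (6)):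
  the characters `χ_q(z) = ∏ⱼ e^{2πi qⱼzⱼ/L}` of `(ℤ/Lℤ)^d` (`torusChar`, Mathlib
  `ZMod.stdAddChar`), their orthogonality `Σ_q χ_q(w) = L^d δ_{w,0}` (`AddChar.sum_mulShift`),
  the exact product-to-sum formula `cos(q·z) cos qᵢ = ½(cos q·(z+eᵢ) + cos q·(z-eᵢ))`, and the
  symmetry `G(x,y) = G(y,x)` of the two-point function;
* `kls_xy_bondCorr_lower_holds : kls_xy_bondCorr_lower` — fact (D), `e₁ ≥ ½ S²`
  (Kennedy–Lieb–Shastry 1988, after eq. (8), "a simple variational argument"): the tracial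
  ground state has energy `E₀ = Re ω(H) = -2 Σ_E G¹(e)` (by (S) and symmetry); the basis state
  `|0…0⟩` rotated by `⨂V`, `V Sᶻ Vᴴ = Sˣ` (`SpinOperatorsProofs`), i.e. all spins along the
  `1`-axis, has energy `-S²|E|` (`xyTorus_trialEnergy`, diagonal matrix elements of bond
  operators in basis states), so `Σ_E G¹ ≥ ½ S²|E|` by `groundEnergy_le_rayleigh`; finally sums
  over site–direction pairs `(x,i) ↦ {x, x+eᵢ}` are `c_L` times sums over edges
  (`sum_pairs_eq_sum_edgeFinset`, `c_L = 2` iff `L = 2`), and `d L^d = c_L |E|`;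
* `kubo_xy_bondCorr_abs_le_holds : kubo_xy_bondCorr_abs_le` — fact (B), Kubo's `|e₃| ≤ e₁` on
  even tori (Kennedy–Lieb–Shastry 1988, after eq. (4): "otherwise the energy could be lowered by
  interchanging the 1 and 3 spin directions"): `H' = U₁HU₁ᴴ = -Σ_E(b³ + b²)` (`U₁ = ⨂Vᴴ`) and
  `H'' = U₂H'U₂ᴴ = -Σ_E(-b³ + b²)` (`U₂ =` the `π`-rotation `V²` about the `2`-axis on the odd
  sublattice; the parity `Σᵢ xᵢ mod 2` through `ZMod.castHom` is well defined on `(ℤ/2kℤ)^d` and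
  alternates along edges) have the ground energy of `H` (`Matrix.groundEnergy_unitary_conj`,
  Mathlib `Unitary.spectrum_star_right_conjugate`), and `E₀(B) ≤ Re ω(B)`
  (`groundEnergy_le_groundStateFunctional_re`) evaluated on the bond sums gives
  `±Σ_E G³ ≤ Σ_E G¹`.

Sources: T. Kennedy, E. H. Lieb, B. S. Shastry, PRL 61 (1988) 2582 ("by symmetry", after
eq. (3); the sum rule, eqs. (3), (6); Kubo's inequality and the variational bound, after eqs. (4)
and (8)); K. Kubo, PRL 61 (1988) 110; F. J. Dyson, E. H. Lieb, B. Simon, J. Stat. Phys. 18 (1978)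
335, §2 (sublattice rotations); H. Tasaki, *Physics and Mathematics of Quantum Many-Body
Systems* (2020), §2.1–2.2; Mathlib `ZMod.stdAddChar`, `AddChar.sum_mulShift` (orthogonality of
characters of `ℤ/Lℤ`).
-/

noncomputable section

open Filter Topology Matrix Finset
open Literature.MathematicalPhysics.QuantumLattice Literature.MathematicalPhysics.QuantumLattice.SpinOperators Literature.Probability.LatticeModels

namespace Matrix

variable {m : Type*} [Fintype m] [DecidableEq m]

/-- **Unitary invariance of the ground energy**: `E₀(U A Uᴴ) = E₀(A)` for unitary `U`
(the spectrum is invariant under conjugation, Mathlib `Unitary.spectrum_star_right_conjugate`).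
Reed–Simon IV §XIII.1. [folklore] -/
theorem groundEnergy_unitary_conj {A U : Matrix m m ℂ} (hU : U ∈ Matrix.unitaryGroup m ℂ) :
    (U * A * Uᴴ).groundEnergy = A.groundEnergy := by
  unfold Matrix.groundEnergy ContinuousLinearMap.groundEnergy
  rw [spectrum_toEuclideanCLM, spectrum_toEuclideanCLM]
  have h := Unitary.spectrum_star_right_conjugate (R := ℂ) (a := A) (U := ⟨U, hU⟩)
  change spectrum ℂ (U * A * star U) = spectrum ℂ A at h
  rw [star_eq_conjTranspose] at h
  rw [h]

end Matrix

namespace Literature.MathematicalPhysics.QuantumLattice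

section QLattice

variable {Λ : Type*} [Fintype Λ] [DecidableEq Λ]

/-! ### Hermiticity of the XXZ Hamiltonian -/

/-- Each XXZ edge term `SˣSˣ + SʸSʸ + Δ SᶻSᶻ` (real `Δ`) is Hermitian. Tasaki (2020) §2.4.
[folklore] -/
theorem xxzEdgeTerm_isHermitian (n : ℕ) (Δ : ℝ) (e : Sym2 Λ) :
    (Sym2.lift ⟨fun x y => spinBond n 0 x y + spinBond n 1 x y + (Δ : ℂ) • spinBond n 2 x y,
      fun x y => by simp only [spinBond_comm]⟩ e : Op Λ (n + 1)).IsHermitian := by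
  induction e using Sym2.ind with
  | h x y =>
    rw [Sym2.lift_mk]
    refine ((spinBond_isHermitian n 0 x y).add (spinBond_isHermitian n 1 x y)).add
      (IsHermitian.smul (spinBond_isHermitian n 2 x y) ?_)
    rw [isSelfAdjoint_iff, Complex.star_def, Complex.conj_ofReal]

/-- The XXZ Hamiltonian with real couplings is Hermitian. Tasaki (2020) §2.4. [folklore] -/
theorem xxzHamiltonian_isHermitian (n : ℕ) (G : SimpleGraph Λ) [DecidableRel G.Adj] (J Δ : ℝ) :
    (xxzHamiltonian n G J Δ).IsHermitian := by
  unfold xxzHamiltonian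
  refine IsHermitian.smul ?_ ?_
  · rw [IsHermitian, conjTranspose_sum]
    exact Finset.sum_congr rfl fun e _ => (xxzEdgeTerm_isHermitian n Δ e).eq
  · rw [isSelfAdjoint_iff, Complex.star_def, Complex.conj_ofReal]

/-! ### Product unitaries acting on bond operators -/

/-- A product unitary rotates a bond operator factorwise:
`U (½(Sᵅ_x Sᵅ_y + Sᵅ_y Sᵅ_x)) Uᴴ = ½ (A_x A_y + A_y A_x)` with `A_z = onSite z (u_z Sᵅ u_zᴴ)`.
Tasaki (2020) §2.2, eq. (2.2.13). [folklore] -/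
theorem productOp_conj_spinBond {n : ℕ} {u : Λ → Matrix (Fin (n + 1)) (Fin (n + 1)) ℂ}
    (hu : ∀ z, u z * (u z)ᴴ = 1) (hu' : ∀ z, (u z)ᴴ * u z = 1) (α : Fin 3) (x y : Λ) :
    productOp u * spinBond n α x y * (productOp u)ᴴ =
      (1 / 2 : ℂ) • ((onSite x (u x * spinVec n α * (u x)ᴴ) : Op Λ (n + 1)) *
          onSite y (u y * spinVec n α * (u y)ᴴ) +
        onSite y (u y * spinVec n α * (u y)ᴴ) * onSite x (u x * spinVec n α * (u x)ᴴ)) := by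
  rw [spinBond, mul_smul_comm, smul_mul_assoc, mul_add, add_mul, productOp_conj_mul hu',
    productOp_conj_mul hu', productOp_conj_siteSpin hu, productOp_conj_siteSpin hu]

/-! ### Diagonal matrix elements of local operators in basis states -/

/-- Diagonal entries of a product of single-site operators at distinct sites:
`⟨σ| a_x b_y |σ⟩ = a_{σ_x σ_x} b_{σ_y σ_y}`. Tasaki (2020) §2.2. [folklore] -/
theorem onSite_mul_onSite_apply_self {q : ℕ} {x y : Λ} (hxy : x ≠ y)
    (a b : Matrix (Fin q) (Fin q) ℂ)
    (σ : TensorIndex Λ q) :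
    (onSite x a * onSite y b : Op Λ q) σ σ = a (σ x) (σ x) * b (σ y) (σ y) := by
  rw [onSite_mul_onSite_eq_productOp hxy, productOp_apply, ← mul_prod_erase _ _ (mem_univ x),
    ← mul_prod_erase _ _ (mem_erase.2 ⟨hxy.symm, mem_univ y⟩), Function.update_self,
    Function.update_of_ne hxy.symm, Function.update_self, prod_eq_one, mul_one]
  intro z hz
  obtain ⟨hzy, hz'⟩ := mem_erase.1 hz
  obtain ⟨hzx, -⟩ := mem_erase.1 hz'
  rw [Function.update_of_ne hzx, Function.update_of_ne hzy, one_apply_eq]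

/-- Diagonal entries of the symmetrised bond operator at distinct sites in a basis state `σ`:
`⟨σ| ½(Sᵅ_x Sᵅ_y + Sᵅ_y Sᵅ_x) |σ⟩ = Sᵅ_{σ_x σ_x} Sᵅ_{σ_y σ_y}`. [folklore] -/
theorem spinBond_apply_self {n : ℕ} {x y : Λ} (hxy : x ≠ y) (α : Fin 3)
    (σ : TensorIndex Λ (n + 1)) :
    spinBond n α x y σ σ = spinVec n α (σ x) (σ x) * spinVec n α (σ y) (σ y) := by
  rw [spinBond, Matrix.smul_apply, Matrix.add_apply, siteSpin, siteSpin,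
    onSite_mul_onSite_apply_self hxy, onSite_mul_onSite_apply_self hxy.symm, smul_eq_mul]
  ring

/-- `⟨0| Sᶻ |0⟩ = S = n/2` (the top weight). Tasaki (2020) §2.1, eq. (2.1.5). [folklore] -/
theorem spinZ_apply_zero_zero (n : ℕ) : spinZ n 0 0 = (n : ℂ) / 2 := by
  rw [spinZ_apply, if_pos rfl, Fin.val_zero, Nat.cast_zero, sub_zero]

/-- `⟨0| Sʸ |0⟩ = 0`. Tasaki (2020) §2.1, eq. (2.1.6). [folklore] -/
theorem spinY_apply_zero_zero (n : ℕ) : spinY n 0 0 = 0 := by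
  rw [spinY, Matrix.smul_apply, Matrix.sub_apply, spinLower_eq_conjTranspose, conjTranspose_apply,
    spinRaise_apply, if_neg (by simp), star_zero, sub_zero, smul_zero]

end QLattice

section Hubbard

variable {d : ℕ}

/-- The XY torus Hamiltonian is Hermitian. [Kennedy–Lieb–Shastry 1988, eq. (1)] [folklore] -/
theorem xyTorus_isHermitian (d L : ℕ) [NeZero L] (n : ℕ) : (xyTorus d L n).IsHermitian :=
  xxzHamiltonian_isHermitian n _ (-1) 0

/-! ### (S) The quarter turn about the `3`-axis: `⟨S²_x S²_y⟩ = ⟨S¹_x S¹_y⟩` -/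

section SymmetryS

variable {Λ : Type*} [Fintype Λ] [DecidableEq Λ]

/-- The global quarter turn `U = ⨂_x D`, `D = diag((-i)^k)`, maps `Sˣ_x ↦ -Sʸ_x`. [folklore] -/
theorem quarterTurn_conj_siteSpin_zero (n : ℕ) (x : Λ) :
    productOp (fun _ : Λ => diagonal fun k : Fin (n + 1) => (-Complex.I) ^ (k : ℕ)) *
        siteSpin n x 0 *
        (productOp (fun _ : Λ => diagonal fun k : Fin (n + 1) => (-Complex.I) ^ (k : ℕ)))ᴴ =
      -siteSpin n x 1 := by
  rw [productOp_conj_siteSpin (fun _ => spinPhase_mul_conjTranspose n), spinVec_zero,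
    spinPhase_conj_spinX, onSite_neg']
  rfl

/-- The global quarter turn maps `Sʸ_x ↦ Sˣ_x`. [folklore] -/
theorem quarterTurn_conj_siteSpin_one (n : ℕ) (x : Λ) :
    productOp (fun _ : Λ => diagonal fun k : Fin (n + 1) => (-Complex.I) ^ (k : ℕ)) *
        siteSpin n x 1 *
        (productOp (fun _ : Λ => diagonal fun k : Fin (n + 1) => (-Complex.I) ^ (k : ℕ)))ᴴ =
      siteSpin n x 0 := by
  rw [productOp_conj_siteSpin (fun _ => spinPhase_mul_conjTranspose n), spinVec_one,
    spinPhase_conj_spinY]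
  rfl

/-- The global quarter turn fixes `Sᶻ_x`. [folklore] -/
theorem quarterTurn_conj_siteSpin_two (n : ℕ) (x : Λ) :
    productOp (fun _ : Λ => diagonal fun k : Fin (n + 1) => (-Complex.I) ^ (k : ℕ)) *
        siteSpin n x 2 *
        (productOp (fun _ : Λ => diagonal fun k : Fin (n + 1) => (-Complex.I) ^ (k : ℕ)))ᴴ =
      siteSpin n x 2 := by
  rw [productOp_conj_siteSpin (fun _ => spinPhase_mul_conjTranspose n), spinVec_two,
    spinPhase_conj_spinZ]
  rfl

/-- The global quarter turn exchanges the `1–1` and `2–2` bond operators: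
`U (spinBond 0) Uᴴ = spinBond 1`. [Kennedy–Lieb–Shastry 1988, "by symmetry"] [folklore] -/
theorem quarterTurn_conj_spinBond_zero (n : ℕ) (x y : Λ) :
    productOp (fun _ : Λ => diagonal fun k : Fin (n + 1) => (-Complex.I) ^ (k : ℕ)) *
        spinBond n 0 x y *
        (productOp (fun _ : Λ => diagonal fun k : Fin (n + 1) => (-Complex.I) ^ (k : ℕ)))ᴴ =
      spinBond n 1 x y := by
  have hu : ∀ z : Λ, (fun _ : Λ => diagonal fun k : Fin (n + 1) => (-Complex.I) ^ (k : ℕ)) z *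
      ((fun _ : Λ => diagonal fun k : Fin (n + 1) => (-Complex.I) ^ (k : ℕ)) z)ᴴ = 1 :=
    fun _ => spinPhase_mul_conjTranspose n
  have hu' : ∀ z : Λ, ((fun _ : Λ => diagonal fun k : Fin (n + 1) => (-Complex.I) ^ (k : ℕ)) z)ᴴ *
      (fun _ : Λ => diagonal fun k : Fin (n + 1) => (-Complex.I) ^ (k : ℕ)) z = 1 :=
    fun _ => spinPhase_conjTranspose_mul n
  rw [productOp_conj_spinBond hu hu', spinVec_zero, spinPhase_conj_spinX, onSite_neg', onSite_neg',
    neg_mul_neg, neg_mul_neg, spinBond]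
  rfl

/-- `U (spinBond 1) Uᴴ = spinBond 0`. [folklore] -/
theorem quarterTurn_conj_spinBond_one (n : ℕ) (x y : Λ) :
    productOp (fun _ : Λ => diagonal fun k : Fin (n + 1) => (-Complex.I) ^ (k : ℕ)) *
        spinBond n 1 x y *
        (productOp (fun _ : Λ => diagonal fun k : Fin (n + 1) => (-Complex.I) ^ (k : ℕ)))ᴴ =
      spinBond n 0 x y := by
  have hu : ∀ z : Λ, (fun _ : Λ => diagonal fun k : Fin (n + 1) => (-Complex.I) ^ (k : ℕ)) z *
      ((fun _ : Λ => diagonal fun k : Fin (n + 1) => (-Complex.I) ^ (k : ℕ)) z)ᴴ = 1 :=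
    fun _ => spinPhase_mul_conjTranspose n
  have hu' : ∀ z : Λ, ((fun _ : Λ => diagonal fun k : Fin (n + 1) => (-Complex.I) ^ (k : ℕ)) z)ᴴ *
      (fun _ : Λ => diagonal fun k : Fin (n + 1) => (-Complex.I) ^ (k : ℕ)) z = 1 :=
    fun _ => spinPhase_conjTranspose_mul n
  rw [productOp_conj_spinBond hu hu', spinVec_one, spinPhase_conj_spinY, spinBond]
  rfl

/-- `U (spinBond 2) Uᴴ = spinBond 2`. [folklore] -/
theorem quarterTurn_conj_spinBond_two (n : ℕ) (x y : Λ) :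
    productOp (fun _ : Λ => diagonal fun k : Fin (n + 1) => (-Complex.I) ^ (k : ℕ)) *
        spinBond n 2 x y *
        (productOp (fun _ : Λ => diagonal fun k : Fin (n + 1) => (-Complex.I) ^ (k : ℕ)))ᴴ =
      spinBond n 2 x y := by
  have hu : ∀ z : Λ, (fun _ : Λ => diagonal fun k : Fin (n + 1) => (-Complex.I) ^ (k : ℕ)) z *
      ((fun _ : Λ => diagonal fun k : Fin (n + 1) => (-Complex.I) ^ (k : ℕ)) z)ᴴ = 1 :=
    fun _ => spinPhase_mul_conjTranspose n
  have hu' : ∀ z : Λ, ((fun _ : Λ => diagonal fun k : Fin (n + 1) => (-Complex.I) ^ (k : ℕ)) z)ᴴ *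
      (fun _ : Λ => diagonal fun k : Fin (n + 1) => (-Complex.I) ^ (k : ℕ)) z = 1 :=
    fun _ => spinPhase_conjTranspose_mul n
  rw [productOp_conj_spinBond hu hu', spinVec_two, spinPhase_conj_spinZ, spinBond]
  rfl

/-- **The XXZ Hamiltonian is `U(1)`-invariant**: the global quarter turn about the `3`-axis
commutes with `xxzHamiltonian n G J Δ` (each edge term `SˣSˣ + SʸSʸ + Δ SᶻSᶻ` is fixed).
Tasaki (2020) §2.4 (remarks after eq. (2.4.1)); Kennedy–Lieb–Shastry 1988. [folklore] -/
theorem quarterTurn_conj_xxzHamiltonian (n : ℕ) (G : SimpleGraph Λ) [DecidableRel G.Adj]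
    (J Δ : ℝ) :
    productOp (fun _ : Λ => diagonal fun k : Fin (n + 1) => (-Complex.I) ^ (k : ℕ)) *
        xxzHamiltonian n G J Δ *
        (productOp (fun _ : Λ => diagonal fun k : Fin (n + 1) => (-Complex.I) ^ (k : ℕ)))ᴴ =
      xxzHamiltonian n G J Δ := by
  set U : Op Λ (n + 1) :=
    productOp (fun _ : Λ => diagonal fun k : Fin (n + 1) => (-Complex.I) ^ (k : ℕ)) with hU
  have hUmem : U ∈ Matrix.unitaryGroup (TensorIndex Λ (n + 1)) ℂ :=
    Matrix.mem_unitaryGroup_iff.mpr (productOp_mul_conjTranspose fun _ =>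
      spinPhase_mul_conjTranspose n)
  set φ := Unitary.conjStarAlgAut ℂ (Op Λ (n + 1)) ⟨U, hUmem⟩ with hφ
  have hφapp : ∀ A : Op Λ (n + 1), φ A = U * A * Uᴴ := fun A => rfl
  rw [← hφapp, xxzHamiltonian, map_smul, map_sum]
  congr 1
  refine Finset.sum_congr rfl fun e _ => ?_
  induction e using Sym2.ind with
  | h x y =>
    rw [Sym2.lift_mk, map_add, map_add, map_smul, hφapp, hφapp, hφapp, hU,
      quarterTurn_conj_spinBond_zero, quarterTurn_conj_spinBond_one, quarterTurn_conj_spinBond_two,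
      add_comm (spinBond n 1 x y)]

end SymmetryS

/-- **Discharge of (S)** `xy_groundCorr_two_eq_one`: `⟨S²_x S²_y⟩_GS = ⟨S¹_x S¹_y⟩_GS` for the XY
torus, by invariance of the tracial ground state under the global quarter turn about the
`3`-axis. [Kennedy–Lieb–Shastry 1988, "by symmetry" after eq. (3)] [folklore] -/
theorem xy_groundCorr_two_eq_one_holds : xy_groundCorr_two_eq_one := by
  intro d L n x y
  rcases Nat.eq_zero_or_pos L with rfl | hL
  · simp
  haveI : NeZero L := ⟨hL.ne'⟩
  rw [xyGroundCorr_of_neZero, xyGroundCorr_of_neZero]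
  set U : Op (TorusSite d L) (n + 1) :=
    productOp (fun _ : TorusSite d L => diagonal fun k : Fin (n + 1) => (-Complex.I) ^ (k : ℕ))
    with hU
  have hUU : Uᴴ * U = 1 := productOp_conjTranspose_mul fun _ => spinPhase_conjTranspose_mul n
  have hcomm : U * xyTorus d L n = xyTorus d L n * U := by
    have h := quarterTurn_conj_xxzHamiltonian n (torusGraph d L) (-1) 0
    have h2 := congrArg (· * U) h
    simp only at h2
    rw [mul_assoc, hUU, mul_one] at h2
    exact h2
  have hinv := groundStateFunctional_conj_of_commute (xyTorus_isHermitian d L n) hcomm hUU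
    (siteSpin n x 1 * siteSpin n y 1)
  rw [productOp_conj_mul (fun _ => spinPhase_conjTranspose_mul n),
    quarterTurn_conj_siteSpin_one, quarterTurn_conj_siteSpin_one] at hinv
  rw [hinv]

/-! ### (T) The a priori bound `|⟨Sᵅ_x Sᵅ_y⟩| ≤ S²` -/

section BoundT

open scoped ComplexOrder MatrixOrder

variable {Λ : Type*} [Fintype Λ] [DecidableEq Λ]

/-- `S·1 - Sᵅ_x ≥ 0` on the many-body space. [folklore] -/
theorem posSemidef_smul_one_sub_siteSpin (n : ℕ) (x : Λ) (α : Fin 3) :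
    Matrix.PosSemidef (((n : ℂ) / 2) • (1 : Op Λ (n + 1)) - siteSpin n x α) := by
  have h : ((n : ℂ) / 2) • (1 : Op Λ (n + 1)) - siteSpin n x α =
      onSite x (((n : ℂ) / 2) • 1 - spinVec n α) := by
    rw [onSite_sub', onSite_smul', onSite_one']
    rfl
  rw [h]
  exact onSite_posSemidef x (posSemidef_smul_one_sub_spinVec n α)

/-- `S·1 + Sᵅ_x ≥ 0` on the many-body space. [folklore] -/
theorem posSemidef_smul_one_add_siteSpin (n : ℕ) (x : Λ) (α : Fin 3) :
    Matrix.PosSemidef (((n : ℂ) / 2) • (1 : Op Λ (n + 1)) + siteSpin n x α) := by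
  have h : ((n : ℂ) / 2) • (1 : Op Λ (n + 1)) + siteSpin n x α =
      onSite x (((n : ℂ) / 2) • 1 + spinVec n α) := by
    rw [onSite_add', onSite_smul', onSite_one']
    rfl
  rw [h]
  exact onSite_posSemidef x (posSemidef_smul_one_add_spinVec n α)

/-- `S²·1 - (Sᵅ_x)² ≥ 0` on the many-body space. [folklore] -/
theorem posSemidef_sq_smul_one_sub_siteSpin_sq (n : ℕ) (x : Λ) (α : Fin 3) :
    Matrix.PosSemidef
      (((n : ℂ) / 2) ^ 2 • (1 : Op Λ (n + 1)) - siteSpin n x α * siteSpin n x α) := by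
  have h : ((n : ℂ) / 2) ^ 2 • (1 : Op Λ (n + 1)) - siteSpin n x α * siteSpin n x α =
      onSite x (((n : ℂ) / 2) ^ 2 • 1 - spinVec n α * spinVec n α) := by
    rw [onSite_sub', onSite_smul', onSite_one', ← onSite_mul]
    rfl
  rw [h]
  exact onSite_posSemidef x (posSemidef_sq_smul_one_sub_spinVec_sq n α)

/-- **`S²·1 - Sᵅ_x Sᵅ_y ≥ 0` for `x ≠ y`**: `2(S² - AB) = (S - A)(S + B) + (S + A)(S - B)` with
commuting positive factors (Mathlib `Commute.mul_nonneg`). [folklore] -/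
theorem posSemidef_sq_smul_one_sub_siteSpin_mul (n : ℕ) {x y : Λ} (hxy : x ≠ y) (α : Fin 3) :
    Matrix.PosSemidef
      (((n : ℂ) / 2) ^ 2 • (1 : Op Λ (n + 1)) - siteSpin n x α * siteSpin n y α) := by
  set c : ℂ := (n : ℂ) / 2 with hc
  set A : Op Λ (n + 1) := siteSpin n x α with hA
  set B : Op Λ (n + 1) := siteSpin n y α with hB
  have hAB : Commute A B := siteSpin_commute_of_ne_holds n hxy α α
  have hc1 : ∀ M : Op Λ (n + 1), Commute (c • 1) M := fun M => (Commute.one_left M).smul_left c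
  have h1 : 0 ≤ (c • 1 - A) * (c • 1 + B) :=
    Commute.mul_nonneg (Matrix.nonneg_iff_posSemidef.mpr (posSemidef_smul_one_sub_siteSpin n x α))
      (Matrix.nonneg_iff_posSemidef.mpr (posSemidef_smul_one_add_siteSpin n y α))
      ((hc1 _).sub_left ((hc1 A).symm.add_right hAB))
  have h2 : 0 ≤ (c • 1 + A) * (c • 1 - B) :=
    Commute.mul_nonneg (Matrix.nonneg_iff_posSemidef.mpr (posSemidef_smul_one_add_siteSpin n x α))
      (Matrix.nonneg_iff_posSemidef.mpr (posSemidef_smul_one_sub_siteSpin n y α))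
      ((hc1 _).add_left ((hc1 A).symm.sub_right hAB))
  have hsum : (c • 1 - A) * (c • 1 + B) + (c • 1 + A) * (c • 1 - B) =
      (2 : ℂ) • (c ^ 2 • (1 : Op Λ (n + 1)) - A * B) := by
    rw [two_smul]
    simp only [mul_add, add_mul, mul_sub, sub_mul, smul_mul_assoc, mul_smul_comm, one_mul, mul_one,
      smul_add, smul_sub, smul_smul, sq]
    abel
  have h3 : (0 : Op Λ (n + 1)) ≤ (2 : ℂ) • (c ^ 2 • (1 : Op Λ (n + 1)) - A * B) := by
    rw [← hsum]
    exact add_nonneg h1 h2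
  have h4 : c ^ 2 • (1 : Op Λ (n + 1)) - A * B =
      (1 / 2 : ℂ) • ((2 : ℂ) • (c ^ 2 • (1 : Op Λ (n + 1)) - A * B)) := by
    rw [smul_smul]
    norm_num
  rw [h4]
  have h5 := (Matrix.nonneg_iff_posSemidef.mp h3).smul (a := (1 / 2 : ℂ)) (by
    rw [Complex.nonneg_iff]; norm_num)
  exact h5

/-- **`S²·1 + Sᵅ_x Sᵅ_y ≥ 0` for `x ≠ y`**: `2(S² + AB) = (S + A)(S + B) + (S - A)(S - B)`.
[folklore] -/
theorem posSemidef_sq_smul_one_add_siteSpin_mul (n : ℕ) {x y : Λ} (hxy : x ≠ y) (α : Fin 3) :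
    Matrix.PosSemidef
      (((n : ℂ) / 2) ^ 2 • (1 : Op Λ (n + 1)) + siteSpin n x α * siteSpin n y α) := by
  set c : ℂ := (n : ℂ) / 2 with hc
  set A : Op Λ (n + 1) := siteSpin n x α with hA
  set B : Op Λ (n + 1) := siteSpin n y α with hB
  have hAB : Commute A B := siteSpin_commute_of_ne_holds n hxy α α
  have hc1 : ∀ M : Op Λ (n + 1), Commute (c • 1) M := fun M => (Commute.one_left M).smul_left c
  have h1 : 0 ≤ (c • 1 + A) * (c • 1 + B) :=
    Commute.mul_nonneg (Matrix.nonneg_iff_posSemidef.mpr (posSemidef_smul_one_add_siteSpin n x α))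
      (Matrix.nonneg_iff_posSemidef.mpr (posSemidef_smul_one_add_siteSpin n y α))
      ((hc1 _).add_left ((hc1 A).symm.add_right hAB))
  have h2 : 0 ≤ (c • 1 - A) * (c • 1 - B) :=
    Commute.mul_nonneg (Matrix.nonneg_iff_posSemidef.mpr (posSemidef_smul_one_sub_siteSpin n x α))
      (Matrix.nonneg_iff_posSemidef.mpr (posSemidef_smul_one_sub_siteSpin n y α))
      ((hc1 _).sub_left ((hc1 A).symm.sub_right hAB))
  have hsum : (c • 1 + A) * (c • 1 + B) + (c • 1 - A) * (c • 1 - B) =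
      (2 : ℂ) • (c ^ 2 • (1 : Op Λ (n + 1)) + A * B) := by
    rw [two_smul]
    simp only [mul_add, add_mul, mul_sub, sub_mul, smul_mul_assoc, mul_smul_comm, one_mul, mul_one,
      smul_add, smul_sub, smul_smul, sq]
    abel
  have h3 : (0 : Op Λ (n + 1)) ≤ (2 : ℂ) • (c ^ 2 • (1 : Op Λ (n + 1)) + A * B) := by
    rw [← hsum]
    exact add_nonneg h1 h2
  have h4 : c ^ 2 • (1 : Op Λ (n + 1)) + A * B =
      (1 / 2 : ℂ) • ((2 : ℂ) • (c ^ 2 • (1 : Op Λ (n + 1)) + A * B)) := by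
    rw [smul_smul]
    norm_num
  rw [h4]
  exact (Matrix.nonneg_iff_posSemidef.mp h3).smul (a := (1 / 2 : ℂ)) (by
    rw [Complex.nonneg_iff]; norm_num)

/-- `S²·1 - Sᵅ_x Sᵅ_y ≥ 0` for all `x, y` (the case `x = y` is `(Sᵅ)² ≤ S²`). [folklore] -/
theorem posSemidef_sq_smul_one_sub_siteSpin_mul' (n : ℕ) (x y : Λ) (α : Fin 3) :
    Matrix.PosSemidef
      (((n : ℂ) / 2) ^ 2 • (1 : Op Λ (n + 1)) - siteSpin n x α * siteSpin n y α) := by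
  by_cases hxy : x = y
  · subst hxy
    exact posSemidef_sq_smul_one_sub_siteSpin_sq n x α
  · exact posSemidef_sq_smul_one_sub_siteSpin_mul n hxy α

/-- `S²·1 + Sᵅ_x Sᵅ_y ≥ 0` for all `x, y` (for `x = y`, `(Sᵅ_x)² = (Sᵅ_x)ᴴ Sᵅ_x ≥ 0`). [folklore] -/
theorem posSemidef_sq_smul_one_add_siteSpin_mul' (n : ℕ) (x y : Λ) (α : Fin 3) :
    Matrix.PosSemidef
      (((n : ℂ) / 2) ^ 2 • (1 : Op Λ (n + 1)) + siteSpin n x α * siteSpin n y α) := by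
  by_cases hxy : x = y
  · subst hxy
    refine PosSemidef.add ?_ ?_
    · refine PosSemidef.smul PosSemidef.one ?_
      rw [Complex.nonneg_iff]
      norm_num [Complex.div_re, Complex.div_im, pow_two]
      positivity
    · have h : siteSpin n x α * siteSpin n x α = (siteSpin n x α)ᴴ * siteSpin n x α := by
        rw [(siteSpin_isHermitian n x α).eq]
      rw [h]
      exact posSemidef_conjTranspose_mul_self _
  · exact posSemidef_sq_smul_one_add_siteSpin_mul n hxy α

end BoundT

section BoundT'

open scoped ComplexOrder

/-- The real part of `(n/2)^2 : ℂ` is `(n/2)^2`. [folklore] -/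
lemma re_half_sq (n : ℕ) : (((n : ℂ) / 2) ^ 2).re = ((n : ℝ) / 2) ^ 2 := by
  have h : ((n : ℂ) / 2) ^ 2 = ((((n : ℝ) / 2) ^ 2 : ℝ) : ℂ) := by push_cast; ring
  rw [h, Complex.ofReal_re]

/-- **Discharge of (T)** `xyGroundCorr_abs_le`: `|Re ⟨Sᵅ_x Sᵅ_y⟩_GS| ≤ S²`, since
`S²·1 ∓ Sᵅ_x Sᵅ_y ≥ 0` and the tracial ground state is a positive normalised functional.
[folklore] -/
theorem xyGroundCorr_abs_le_holds : xyGroundCorr_abs_le := by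
  intro α d L n x y
  rcases Nat.eq_zero_or_pos L with rfl | hL
  · simp only [xyGroundCorr_zero_side, abs_zero]
    positivity
  haveI : NeZero L := ⟨hL.ne'⟩
  rw [xyGroundCorr_of_neZero]
  set H := xyTorus d L n with hH
  have hHerm : H.IsHermitian := xyTorus_isHermitian d L n
  set O : Op (TorusSite d L) (n + 1) := siteSpin n x α * siteSpin n y α with hO
  have hone : H.groundStateFunctional 1 = 1 := groundStateFunctional_one hHerm
  -- upper bound from `S²·1 - O ≥ 0`
  have hup := groundStateFunctional_nonneg_of_posSemidef H
    (posSemidef_sq_smul_one_sub_siteSpin_mul' n x y α)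
  rw [map_sub, LinearMap.map_smul, hone, smul_eq_mul, mul_one] at hup
  obtain ⟨hup_re, -⟩ := Complex.nonneg_iff.mp hup
  rw [Complex.sub_re, re_half_sq] at hup_re
  -- lower bound from `S²·1 + O ≥ 0`
  have hlo := groundStateFunctional_nonneg_of_posSemidef H
    (posSemidef_sq_smul_one_add_siteSpin_mul' n x y α)
  rw [map_add, LinearMap.map_smul, hone, smul_eq_mul, mul_one] at hlo
  obtain ⟨hlo_re, -⟩ := Complex.nonneg_iff.mp hlo
  rw [Complex.add_re, re_half_sq] at hlo_re
  rw [abs_le]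
  constructor <;> linarith

end BoundT'

/-! ### (C) Characters of the dual torus and the sum rule -/

section SumRule

/-! Below, `χ_q(z) = ∏ⱼ e(qⱼ zⱼ)` (`e = ZMod.stdAddChar`, `e(a) = exp(2πi a/L)`) is the character of
`(ℤ/Lℤ)^d` attached to the dual point `q`; it is written out in full (no new definition). -/

/-- `χ_q(z + w) = χ_q(z) χ_q(w)`. [folklore] -/
theorem torusChar_add (L : ℕ) [NeZero L] (q z w : TorusSite d L) :
    (∏ j, (ZMod.stdAddChar (q j * (z + w) j) : ℂ)) =
      (∏ j, (ZMod.stdAddChar (q j * z j) : ℂ)) * ∏ j, (ZMod.stdAddChar (q j * w j) : ℂ) := by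
  rw [← prod_mul_distrib]
  refine prod_congr rfl fun j _ => ?_
  rw [Pi.add_apply, mul_add, AddChar.map_add_eq_mul]

/-- `χ_q(-w) = conj χ_q(w)` (values on the unit circle). [folklore] -/
theorem torusChar_neg (L : ℕ) [NeZero L] (q w : TorusSite d L) :
    (∏ j, (ZMod.stdAddChar (q j * (-w) j) : ℂ)) =
      star (∏ j, (ZMod.stdAddChar (q j * w j) : ℂ)) := by
  rw [star_prod]
  refine prod_congr rfl fun j _ => ?_
  rw [Pi.neg_apply, mul_neg, ZMod.stdAddChar_apply, ZMod.stdAddChar_apply,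
    AddChar.map_neg_eq_inv, Circle.coe_inv_eq_conj]
  rfl

/-- The standard character at a product, through canonical representatives:
`e(ab) = exp(2πi a.val b.val / L)`. [folklore] -/
theorem stdAddChar_mul_eq_exp (L : ℕ) [NeZero L] (a b : ZMod L) :
    (ZMod.stdAddChar (a * b) : ℂ) =
      Complex.exp (((2 * Real.pi * ((a.val : ℝ) * (b.val : ℝ)) / L : ℝ) : ℂ) * Complex.I) := by
  conv_lhs => rw [← ZMod.natCast_zmod_val a, ← ZMod.natCast_zmod_val b, ← Nat.cast_mul]
  rw [ZMod.stdAddChar_apply, ZMod.toCircle_natCast]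
  congr 1
  push_cast
  ring

/-- `χ_q(z) = exp(i p·z)` with the phase `torusPhase`. [folklore] -/
theorem torusChar_eq_exp (L : ℕ) [NeZero L] (q z : TorusSite d L) :
    (∏ j, (ZMod.stdAddChar (q j * z j) : ℂ)) =
      Complex.exp ((torusPhase L q z : ℂ) * Complex.I) := by
  unfold torusPhase
  simp_rw [stdAddChar_mul_eq_exp]
  rw [← Complex.exp_sum, ← sum_mul, ← Complex.ofReal_sum, mul_sum, sum_div]

/-- `Re χ_q(z) = cos (p · z)`. [folklore] -/
theorem torusChar_re (L : ℕ) [NeZero L] (q z : TorusSite d L) :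
    (∏ j, (ZMod.stdAddChar (q j * z j) : ℂ)).re = Real.cos (torusPhase L q z) := by
  rw [torusChar_eq_exp, Complex.exp_ofReal_mul_I_re]

/-- `χ_q(eᵢ) = e^{i pᵢ}`, so `Re χ_q(eᵢ) = cos pᵢ` with `pᵢ = latticeMomentum L q i`. [folklore] -/
theorem torusChar_single_re (L : ℕ) [NeZero L] (q : TorusSite d L) (i : Fin d) :
    (∏ j, (ZMod.stdAddChar (q j * (Pi.single i 1 : TorusSite d L) j) : ℂ)).re =
      Real.cos (latticeMomentum L q i) := by
  have h : (∏ j, (ZMod.stdAddChar (q j * (Pi.single i 1 : TorusSite d L) j) : ℂ)) =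
      (ZMod.stdAddChar (q i * 1) : ℂ) := by
    rw [← prod_erase_mul _ _ (mem_univ i), Pi.single_eq_same, prod_eq_one, one_mul]
    intro j hj
    rw [Pi.single_eq_of_ne (ne_of_mem_erase hj), mul_zero, AddChar.map_zero_eq_one]
  rw [h, ← ZMod.natCast_zmod_val (q i), mul_one, ZMod.stdAddChar_apply, ZMod.toCircle_natCast,
    latticeMomentum_apply]
  have : (2 * Real.pi * Complex.I * ((q i).val : ℕ) / (L : ℂ)) =
      ((2 * Real.pi * ((q i).val : ℝ) / L : ℝ) : ℂ) * Complex.I := by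
    push_cast
    ring
  rw [this, Complex.exp_ofReal_mul_I_re]

/-- **Orthogonality of characters** on `(ℤ/Lℤ)^d`: `Σ_q χ_q(w) = L^d δ_{w,0}`. [folklore] -/
theorem sum_torusChar (L : ℕ) [NeZero L] (w : TorusSite d L) :
    ∑ q : TorusSite d L, (∏ j, (ZMod.stdAddChar (q j * w j) : ℂ)) =
      if w = 0 then ((L : ℂ) ^ d) else 0 := by
  have h := (Finset.prod_univ_sum (fun (_ : Fin d) => (univ : Finset (ZMod L)))
    (fun j a => (ZMod.stdAddChar (a * w j) : ℂ))).symm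
  rw [Fintype.piFinset_univ] at h
  rw [h]
  simp_rw [AddChar.sum_mulShift _ (ZMod.isPrimitive_stdAddChar L), ZMod.card, Nat.cast_ite,
    Nat.cast_zero]
  split_ifs with hw
  · subst hw
    simp
  · obtain ⟨j, hj⟩ : ∃ j, w j ≠ 0 := by
      by_contra hc
      push Not at hc
      exact hw (funext hc)
    exact prod_eq_zero (mem_univ j) (if_neg hj)

/-- Real form: `Σ_q cos(p_q · w) = L^d δ_{w,0}`. [folklore] -/
theorem sum_cos_torusPhase (L : ℕ) [NeZero L] (w : TorusSite d L) :
    ∑ q : TorusSite d L, Real.cos (torusPhase L q w) = if w = 0 then ((L : ℝ) ^ d) else 0 := by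
  have h := congrArg Complex.re (sum_torusChar L w)
  rw [Complex.re_sum] at h
  simp_rw [torusChar_re] at h
  rw [h]
  split_ifs
  · rw [← Complex.ofReal_natCast, ← Complex.ofReal_pow, Complex.ofReal_re]
  · rfl

/-- The product-to-sum step: `cos(p·z) cos pᵢ = ½ (cos(p·(z + eᵢ)) + cos(p·(z - eᵢ)))`, exactly
on the discrete torus (through the characters). [folklore] -/
theorem cos_torusPhase_mul_cos_latticeMomentum (L : ℕ) [NeZero L] (q z : TorusSite d L)
    (i : Fin d) :
    Real.cos (torusPhase L q z) * Real.cos (latticeMomentum L q i) =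
      (Real.cos (torusPhase L q (z + Pi.single i 1)) +
        Real.cos (torusPhase L q (z - Pi.single i 1))) / 2 := by
  rw [← torusChar_re, ← torusChar_single_re, ← torusChar_re, ← torusChar_re, torusChar_add,
    sub_eq_add_neg, torusChar_add, torusChar_neg]
  simp only [Complex.mul_re, Complex.star_def, Complex.conj_re, Complex.conj_im]
  ring

/-- **The Fourier core of the sum rule**: for a symmetric kernel `G` on the torus of side `L`,
`Σ_q (Σ_{x,y} cos(p_q·(x-y)) G(x,y)) cos (p_q)ᵢ = L^d Σ_x G(x, x + eᵢ)`. [Kennedy–Lieb–Shastry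
1988, eqs. (3), (6)] [folklore] -/
theorem sum_structureFactor_mul_cos (L : ℕ) [NeZero L] (G : TorusSite d L → TorusSite d L → ℝ)
    (hG : ∀ x y, G x y = G y x) (i : Fin d) :
    ∑ q : TorusSite d L, (∑ x : TorusSite d L, ∑ y : TorusSite d L,
        Real.cos (torusPhase L q (x - y)) * G x y) * Real.cos (latticeMomentum L q i) =
      (L : ℝ) ^ d * ∑ x : TorusSite d L, G x (x + Pi.single i 1) := by
  set e : TorusSite d L := Pi.single i 1 with he
  -- expand, exchange the momentum sum with the site sums, and use orthogonality
  have h1 : ∀ x y : TorusSite d L,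
      ∑ q : TorusSite d L, Real.cos (torusPhase L q (x - y)) * G x y *
        Real.cos (latticeMomentum L q i) =
      G x y * (((if x - y + e = 0 then ((L : ℝ) ^ d) else 0) +
        (if x - y - e = 0 then ((L : ℝ) ^ d) else 0)) / 2) := by
    intro x y
    have : ∀ q : TorusSite d L, Real.cos (torusPhase L q (x - y)) * G x y *
        Real.cos (latticeMomentum L q i) =
        G x y * ((Real.cos (torusPhase L q (x - y + e)) +
          Real.cos (torusPhase L q (x - y - e))) / 2) := by
      intro q
      rw [mul_right_comm, cos_torusPhase_mul_cos_latticeMomentum, mul_comm]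
    simp_rw [this]
    rw [← mul_sum, ← sum_div, sum_add_distrib, sum_cos_torusPhase, sum_cos_torusPhase]
  have hswap : ∑ q : TorusSite d L, (∑ x : TorusSite d L, ∑ y : TorusSite d L,
      Real.cos (torusPhase L q (x - y)) * G x y) * Real.cos (latticeMomentum L q i) =
      ∑ x : TorusSite d L, ∑ y : TorusSite d L, ∑ q : TorusSite d L,
        Real.cos (torusPhase L q (x - y)) * G x y * Real.cos (latticeMomentum L q i) := by
    simp_rw [sum_mul]
    rw [sum_comm]
    exact sum_congr rfl fun x _ => sum_comm
  rw [hswap]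
  simp_rw [h1]
  -- the two Kronecker deltas
  have h2 : ∀ x : TorusSite d L, ∑ y : TorusSite d L,
      G x y * (((if x - y + e = 0 then ((L : ℝ) ^ d) else 0) +
        (if x - y - e = 0 then ((L : ℝ) ^ d) else 0)) / 2) =
      (L : ℝ) ^ d / 2 * (G x (x + e) + G x (x - e)) := by
    intro x
    have hα : ∀ y : TorusSite d L, (x - y + e = 0) ↔ (y = x + e) := fun y => by
      constructor <;> intro h
      · rw [← sub_eq_zero]; rw [← neg_eq_zero, ← h]; abel
      · rw [h]; abel
    have hβ : ∀ y : TorusSite d L, (x - y - e = 0) ↔ (y = x - e) := fun y => by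
      constructor <;> intro h
      · rw [← sub_eq_zero]; rw [← neg_eq_zero, ← h]; abel
      · rw [h]; abel
    have hA : ∀ y : TorusSite d L, (if x - y + e = 0 then ((L : ℝ) ^ d) else 0) =
        if y = x + e then ((L : ℝ) ^ d) else 0 := fun y => if_congr (hα y) rfl rfl
    have hB : ∀ y : TorusSite d L, (if x - y - e = 0 then ((L : ℝ) ^ d) else 0) =
        if y = x - e then ((L : ℝ) ^ d) else 0 := fun y => if_congr (hβ y) rfl rfl
    simp_rw [hA, hB]
    have hterm : ∀ y : TorusSite d L, G x y * (((if y = x + e then ((L : ℝ) ^ d) else 0) +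
        (if y = x - e then ((L : ℝ) ^ d) else 0)) / 2) =
        (if y = x + e then (L : ℝ) ^ d / 2 * G x y else 0) +
          (if y = x - e then (L : ℝ) ^ d / 2 * G x y else 0) := by
      intro y
      split_ifs <;> ring
    simp_rw [hterm]
    rw [sum_add_distrib, sum_ite_eq' univ (x + e), sum_ite_eq' univ (x - e)]
    simp only [mem_univ, if_true]
    ring
  simp_rw [h2]
  rw [← mul_sum, sum_add_distrib]
  -- reindex the second sum and use the symmetry of `G`
  have h3 : ∑ x : TorusSite d L, G x (x - e) = ∑ x : TorusSite d L, G x (x + e) := by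
    rw [← Equiv.sum_comp (Equiv.addRight e) (fun x => G x (x - e))]
    refine sum_congr rfl fun x _ => ?_
    simp only [Equiv.coe_addRight, add_sub_cancel_right]
    exact hG _ _
  rw [h3]
  ring

/-- The ground-state two-point function is symmetric: `G^α(x,y) = G^α(y,x)`
(`ω((S_x S_y)ᴴ) = conj ω(S_x S_y)` and `(S_x S_y)ᴴ = S_y S_x`). [folklore] -/
theorem xyGroundCorr_symm (α : Fin 3) (L n : ℕ) (x y : TorusSite d L) :
    xyGroundCorr α L n x y = xyGroundCorr α L n y x := by
  rcases Nat.eq_zero_or_pos L with rfl | hL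
  · simp
  haveI : NeZero L := ⟨hL.ne'⟩
  rw [xyGroundCorr_of_neZero, xyGroundCorr_of_neZero]
  have h : siteSpin n y α * siteSpin n x α = (siteSpin n x α * siteSpin n y α)ᴴ := by
    rw [conjTranspose_mul, (siteSpin_isHermitian n x α).eq, (siteSpin_isHermitian n y α).eq]
  rw [h, groundStateFunctional_conjTranspose_re]

/-- **Discharge of (C)** `xy_structureFactor_sumRule`: the finite-volume sum rule
`|Λ|⁻¹ Σ_q ĝ^α_q (d⁻¹ Σᵢ cos qᵢ) = e_α` (Kennedy–Lieb–Shastry 1988, eqs. (3), (6)), by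
orthogonality of the characters of `(ℤ/Lℤ)^d` and the symmetry of the two-point function.
[Kennedy–Lieb–Shastry 1988, eqs. (3), (6)] [cite: KLS1988PRL, eq. (6)] -/
theorem xy_structureFactor_sumRule_holds : xy_structureFactor_sumRule := by
  intro d hd α L _ n hL
  have hd0 : (d : ℝ) ≠ 0 := by exact_mod_cast (show d ≠ 0 by omega)
  have hL0 : (L : ℝ) ^ d ≠ 0 := by
    have : (L : ℝ) ≠ 0 := by exact_mod_cast NeZero.ne L
    positivity
  simp_rw [xyStructureFactor_of_neZero, torusCosSum, xyBondCorr_of_neZero]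
  have h : ∀ q : TorusSite d L,
      (∑ x : TorusSite d L, ∑ y : TorusSite d L,
          Real.cos (torusPhase L q (x - y)) * xyGroundCorr α L n x y) / (L : ℝ) ^ d *
        ((∑ i : Fin d, Real.cos (latticeMomentum L q i)) / d) =
      (∑ i : Fin d, (∑ x : TorusSite d L, ∑ y : TorusSite d L,
          Real.cos (torusPhase L q (x - y)) * xyGroundCorr α L n x y) *
        Real.cos (latticeMomentum L q i)) / ((d : ℝ) * (L : ℝ) ^ d) := by
    intro q
    rw [div_mul_div_comm, mul_sum, mul_comm ((L : ℝ) ^ d) (d : ℝ)]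
  simp_rw [h]
  rw [← sum_div, sum_comm]
  simp_rw [sum_structureFactor_mul_cos L (xyGroundCorr α L n) (xyGroundCorr_symm α L n)]
  rw [← mul_sum, sum_comm]
  field_simp

end SumRule

/-! ### (D) The variational bound `e₁ ≥ ½ S²` -/

section BoundD

/-- Real part of `ω` on a symmetrised bond: `Re ω(½(Sᵅ_x Sᵅ_y + Sᵅ_y Sᵅ_x)) = G^α(x,y)`.
[folklore] -/
theorem re_groundStateFunctional_spinBond (L : ℕ) [NeZero L] (n : ℕ) (α : Fin 3)
    (x y : TorusSite d L) :
    ((xyTorus d L n).groundStateFunctional (spinBond n α x y)).re = xyGroundCorr α L n x y := by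
  rw [spinBond, LinearMap.map_smul, map_add, smul_eq_mul,
    show (1 / 2 : ℂ) = ((1 / 2 : ℝ) : ℂ) by push_cast; ring, Complex.re_ofReal_mul,
    Complex.add_re, ← xyGroundCorr_of_neZero, ← xyGroundCorr_of_neZero, xyGroundCorr_symm α L n y x]
  ring

/-- **The ground energy of the XY torus, edge by edge**: `Re ω(H) = -2 Σ_{e ∈ E} G¹(e)` (by
`G² = G¹`, fact (S), and the symmetry of `G¹`). [Kennedy–Lieb–Shastry 1988, eq. (1)] [folklore] -/
theorem re_groundStateFunctional_xyTorus (L : ℕ) [NeZero L] (n : ℕ) :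
    ((xyTorus d L n).groundStateFunctional (xyTorus d L n)).re =
      -2 * ∑ e ∈ (torusGraph d L).edgeFinset, Sym2.lift
        ⟨fun x y => xyGroundCorr 0 L n x y, fun x y => xyGroundCorr_symm 0 L n x y⟩ e := by
  have hS : ∀ x y : TorusSite d L, xyGroundCorr 1 L n x y = xyGroundCorr 0 L n x y :=
    fun x y => xy_groundCorr_two_eq_one_holds d L n x y
  have key : ∀ x y : TorusSite d L, ((xyTorus d L n).groundStateFunctional
      (spinBond n 0 x y + spinBond n 1 x y + ((0 : ℝ) : ℂ) • spinBond n 2 x y)).re =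
      2 * xyGroundCorr 0 L n x y := by
    intro x y
    rw [map_add, map_add, Complex.add_re, Complex.add_re, re_groundStateFunctional_spinBond,
      re_groundStateFunctional_spinBond, LinearMap.map_smul, Complex.ofReal_zero, zero_smul,
      Complex.zero_re, add_zero, hS]
    ring
  rw [show (xyTorus d L n).groundStateFunctional (xyTorus d L n) =
    (xyTorus d L n).groundStateFunctional (((-1 : ℝ) : ℂ) • ∑ e ∈ (torusGraph d L).edgeFinset,
      Sym2.lift ⟨fun x y => spinBond n 0 x y + spinBond n 1 x y + ((0 : ℝ) : ℂ) • spinBond n 2 x y,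
        fun x y => by simp only [spinBond_comm]⟩ e) from rfl]
  rw [LinearMap.map_smul, map_sum, smul_eq_mul, Complex.re_ofReal_mul, Complex.re_sum, neg_mul,
    one_mul, neg_mul, neg_inj, mul_sum]
  refine sum_congr rfl fun e _ => ?_
  induction e using Sym2.ind with
  | h x y => rw [Sym2.lift_mk, Sym2.lift_mk, key]

/-- **The trial energy**: for a unitary `V` with `V Sᶻ Vᴴ = Sˣ`, `V Sʸ Vᴴ = Sʸ`, the rotated
basis state `(⨂ V)|0…0⟩` (all spins `S¹ = +S`) has energy `-S² |E|` in the XY torus: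
`⟨0…0| (⨂Vᴴ) H (⨂Vᴴ)ᴴ |0…0⟩ = -S² |E|`. [Kennedy–Lieb–Shastry 1988, after eq. (8) ("a
simple variational argument")] [folklore] -/
theorem xyTorus_trialEnergy (L : ℕ) [NeZero L] (n : ℕ) {V : Matrix (Fin (n + 1)) (Fin (n + 1)) ℂ}
    (hV : V * Vᴴ = 1) (hV' : Vᴴ * V = 1) (hVz : V * SpinOperators.spinZ n * Vᴴ = spinX n)
    (hVy : V * spinY n * Vᴴ = spinY n) :
    (productOp (fun _ : TorusSite d L => Vᴴ) * xyTorus d L n *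
        (productOp (fun _ : TorusSite d L => Vᴴ))ᴴ) (fun _ => 0) (fun _ => 0) =
      -((((n : ℂ) / 2) ^ 2) * ((torusGraph d L).edgeFinset.card : ℂ)) := by
  set u : TorusSite d L → Matrix (Fin (n + 1)) (Fin (n + 1)) ℂ := fun _ => Vᴴ with hu_def
  have hu : ∀ z, u z * (u z)ᴴ = 1 := fun _ => by rw [hu_def, conjTranspose_conjTranspose, hV']
  have hu' : ∀ z, (u z)ᴴ * u z = 1 := fun _ => by rw [hu_def, conjTranspose_conjTranspose, hV]
  have hx : Vᴴ * spinX n * V = SpinOperators.spinZ n := by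
    rw [← hVz, ← mul_assoc, ← mul_assoc, hV', one_mul, mul_assoc, hV', mul_one]
  have hy : Vᴴ * spinY n * V = spinY n := by
    conv_lhs => rw [← hVy]
    rw [← mul_assoc, ← mul_assoc, hV', one_mul, mul_assoc, hV', mul_one]
  have hb0 : ∀ x y : TorusSite d L,
      productOp u * spinBond n 0 x y * (productOp u)ᴴ = spinBond n 2 x y := by
    intro x y
    rw [productOp_conj_spinBond hu hu', spinVec_zero, hu_def]
    simp only [conjTranspose_conjTranspose, hx]
    rfl
  have hb1 : ∀ x y : TorusSite d L,
      productOp u * spinBond n 1 x y * (productOp u)ᴴ = spinBond n 1 x y := by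
    intro x y
    rw [productOp_conj_spinBond hu hu', spinVec_one, hu_def]
    simp only [conjTranspose_conjTranspose, hy]
    rfl
  -- conjugate the Hamiltonian edge by edge
  rw [xyTorus, xxzHamiltonian, mul_smul_comm, smul_mul_assoc, mul_sum, sum_mul, Matrix.smul_apply,
    Matrix.sum_apply, smul_eq_mul, Complex.ofReal_neg, Complex.ofReal_one, neg_one_mul, neg_inj,
    ← nsmul_eq_mul', ← sum_const]
  refine sum_congr rfl fun e he => ?_
  induction e using Sym2.ind with
  | h x y =>
    have hxy : x ≠ y := by
      intro h
      exact SimpleGraph.not_isDiag_of_mem_edgeSet _ (SimpleGraph.mem_edgeFinset.1 he)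
        (by rw [h]; exact Sym2.mk_isDiag_iff.2 rfl)
    rw [Sym2.lift_mk, mul_add, add_mul, mul_add, add_mul, hb0, hb1, mul_smul_comm, smul_mul_assoc,
      Complex.ofReal_zero, zero_smul, add_zero, Matrix.add_apply, spinBond_apply_self hxy,
      spinBond_apply_self hxy, spinVec_two, spinVec_one, spinZ_apply_zero_zero,
      spinY_apply_zero_zero]
    ring

/-- The number of edges of the torus graph in terms of the site–direction pairs, and sums over
edges versus sums over pairs `(x, i) ↦ {x, x + eᵢ}`: every edge arises from `c_L` pairs, with
`c_L = 2` for `L = 2` (where `x + eᵢ = x - eᵢ`) and `c_L = 1` for `L ≥ 3`. [folklore] -/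
theorem sum_pairs_eq_sum_edgeFinset (L : ℕ) [NeZero L] (hL : 2 ≤ L) (f : Sym2 (TorusSite d L) → ℝ) :
    ∑ x : TorusSite d L, ∑ i : Fin d, f s(x, x + Pi.single i 1) =
      (if L = 2 then (2 : ℝ) else 1) * ∑ e ∈ (torusGraph d L).edgeFinset, f e := by
  haveI : Fact (1 < L) := ⟨hL⟩
  set φ : TorusSite d L × Fin d → Sym2 (TorusSite d L) :=
    fun p => s(p.1, p.1 + Pi.single p.2 1) with hφ
  -- basic facts on the unit vectors
  have hne : ∀ i : Fin d, (Pi.single i (1 : ZMod L) : TorusSite d L) ≠ 0 := by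
    intro i h
    have := congrFun h i
    rw [Pi.single_eq_same, Pi.zero_apply] at this
    exact one_ne_zero this
  have hinj : ∀ i j : Fin d,
      (Pi.single i (1 : ZMod L) : TorusSite d L) = Pi.single j 1 → i = j := by
    intro i j h
    by_contra hij
    have := congrFun h i
    rw [Pi.single_eq_same, Pi.single_eq_of_ne hij] at this
    exact one_ne_zero this
  have hsum0 : ∀ i j : Fin d, (Pi.single j (1 : ZMod L) : TorusSite d L) + Pi.single i 1 = 0 ↔
      i = j ∧ L = 2 := by
    intro i j
    constructor
    · intro h
      by_cases hij : i = j
      · subst hij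
        refine ⟨rfl, ?_⟩
        have h2 := congrFun h i
        rw [Pi.add_apply, Pi.single_eq_same, Pi.zero_apply, show (1 : ZMod L) + 1 = (2 : ℕ) by
          norm_num, ZMod.natCast_eq_zero_iff] at h2
        exact le_antisymm (Nat.le_of_dvd two_pos h2) hL
      · have h2 := congrFun h i
        rw [Pi.add_apply, Pi.single_eq_same, Pi.single_eq_of_ne hij, Pi.zero_apply, zero_add] at h2
        exact absurd h2 one_ne_zero
    · rintro ⟨hij, hL2⟩
      subst hij
      funext k
      rw [Pi.add_apply, Pi.zero_apply]
      by_cases hk : k = i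
      · subst hk
        rw [Pi.single_eq_same, show (1 : ZMod L) + 1 = (2 : ℕ) by norm_num,
          ZMod.natCast_eq_zero_iff, hL2]
      · rw [Pi.single_eq_of_ne hk, add_zero]
  -- `φ` maps pairs to edges
  have hmaps : ∀ p ∈ (univ : Finset (TorusSite d L × Fin d)),
      φ p ∈ (torusGraph d L).edgeFinset := by
    intro p _
    rw [SimpleGraph.mem_edgeFinset, hφ, SimpleGraph.mem_edgeSet, torusGraph_adj_iff]
    refine ⟨fun h => hne p.2 ?_, Or.inl ⟨p.2, rfl⟩⟩
    have := congrArg (· - p.1) h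
    simpa using this.symm
  -- every fibre has `c_L` elements
  have hfib : ∀ e ∈ (torusGraph d L).edgeFinset,
      ((univ : Finset (TorusSite d L × Fin d)).filter (fun p => φ p = e)).card =
        if L = 2 then 2 else 1 := by
    intro e he
    -- write `e = {a, a + e_j}`
    obtain ⟨a, j, rfl⟩ : ∃ (a : TorusSite d L) (j : Fin d), e = s(a, a + Pi.single j 1) := by
      induction e using Sym2.ind with
      | h a b =>
        rw [SimpleGraph.mem_edgeFinset, SimpleGraph.mem_edgeSet, torusGraph_adj_iff] at he
        obtain ⟨-, ⟨j, hj⟩ | ⟨j, hj⟩⟩ := he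
        · exact ⟨a, j, by rw [hj]⟩
        · exact ⟨b, j, by rw [hj, Sym2.eq_swap]⟩
    have hmem : ∀ p : TorusSite d L × Fin d, φ p = s(a, a + Pi.single j 1) ↔
        p = (a, j) ∨ (L = 2 ∧ p = (a + Pi.single j 1, j)) := by
      rintro ⟨x, i⟩
      rw [hφ]
      simp only [Sym2.eq_iff, Prod.mk.injEq]
      constructor
      · rintro (⟨rfl, h⟩ | ⟨rfl, h⟩)
        · exact Or.inl ⟨rfl, hinj _ _ (add_left_cancel h)⟩
        · rw [add_assoc, add_eq_left] at h
          obtain ⟨hij, hL2⟩ := (hsum0 i j).1 h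
          exact Or.inr ⟨hL2, rfl, hij⟩
      · rintro (⟨hx, hij⟩ | ⟨hL2, hx, hij⟩)
        · rw [hx, hij]
          exact Or.inl ⟨rfl, rfl⟩
        · rw [hx, hij]
          refine Or.inr ⟨rfl, ?_⟩
          rw [add_assoc, add_eq_left]
          exact (hsum0 j j).2 ⟨rfl, hL2⟩
    split_ifs with hL2
    · have hset : (univ : Finset (TorusSite d L × Fin d)).filter
          (fun p => φ p = s(a, a + Pi.single j 1)) = {(a, j), (a + Pi.single j 1, j)} := by
        ext p
        rw [mem_filter, mem_insert, mem_singleton, hmem]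
        simp [hL2]
      rw [hset, card_pair]
      intro h
      have := (Prod.mk.inj h).1
      exact hne j (by simpa using this.symm)
    · have hset : (univ : Finset (TorusSite d L × Fin d)).filter
          (fun p => φ p = s(a, a + Pi.single j 1)) = {(a, j)} := by
        ext p
        rw [mem_filter, mem_singleton, hmem]
        simp [hL2]
      rw [hset, card_singleton]
  -- assemble
  calc ∑ x : TorusSite d L, ∑ i : Fin d, f s(x, x + Pi.single i 1)
      = ∑ p : TorusSite d L × Fin d, f (φ p) := by rw [← univ_product_univ, sum_product]
    _ = ∑ e ∈ (torusGraph d L).edgeFinset,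
          ∑ p ∈ (univ : Finset (TorusSite d L × Fin d)) with φ p = e, f e :=
        (sum_fiberwise_of_maps_to' hmaps f).symm
    _ = ∑ e ∈ (torusGraph d L).edgeFinset, (if L = 2 then (2 : ℝ) else 1) * f e := by
        refine sum_congr rfl fun e he => ?_
        rw [sum_const, hfib e he, nsmul_eq_mul]
        split_ifs <;> simp
    _ = _ := by rw [mul_sum]

/-- **Discharge of (D)** `kls_xy_bondCorr_lower`: `e₁ ≥ ½ S²`. The tracial ground state has
energy `E₀ = Re ω(H) = -2 Σ_E G¹(e)`; the product state with all spins along the `1`-axis (a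
rotated basis vector) has energy `-S²|E|`, so `E₀ ≤ -S²|E|` by the variational principle
(`groundEnergy_le_rayleigh`), i.e. the edge average of `G¹` is `≥ ½S²`; the pair average `e₁`
equals the edge average (every edge comes from the same number `c_L` of pairs `(x, i)`).
[Kennedy–Lieb–Shastry 1988, after eq. (8)] [cite: KLS1988PRL, after eq. (8)] -/
theorem kls_xy_bondCorr_lower_holds : kls_xy_bondCorr_lower := by
  intro d hd L n hL
  haveI : NeZero L := ⟨by omega⟩
  set E := (torusGraph d L).edgeFinset with hE
  set g : Sym2 (TorusSite d L) → ℝ :=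
    Sym2.lift ⟨fun x y => xyGroundCorr 0 L n x y, fun x y => xyGroundCorr_symm 0 L n x y⟩ with hg
  have hHerm : (xyTorus d L n).IsHermitian := xyTorus_isHermitian d L n
  -- (1) the ground energy is `-2 Σ_E g`
  have h1 : (xyTorus d L n).groundEnergy = -2 * ∑ e ∈ E, g e := by
    rw [← re_groundStateFunctional_xyTorus, groundStateFunctional_hamiltonian hHerm,
      Complex.ofReal_re]
  -- (2) the trial state
  obtain ⟨V, hV, hV', hVz, -, hVy⟩ := exists_unitary_conj_spinZ_eq_spinX n
  set W : Op (TorusSite d L) (n + 1) := productOp (fun _ : TorusSite d L => Vᴴ) with hW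
  have hWW : W * Wᴴ = 1 :=
    productOp_mul_conjTranspose fun _ => by rw [conjTranspose_conjTranspose, hV']
  set v : TensorIndex (TorusSite d L) (n + 1) → ℂ := Pi.single (fun _ => 0) 1 with hv
  have hstar : star v = v := by rw [hv, ← Pi.single_star, star_one]
  have hψ : star (Wᴴ *ᵥ v) ⬝ᵥ (Wᴴ *ᵥ v) = 1 := by
    rw [star_mulVec, conjTranspose_conjTranspose, ← dotProduct_mulVec, mulVec_mulVec, hWW,
      one_mulVec, hstar, hv, single_dotProduct, Pi.single_eq_same, one_mul]
  have h2 := groundEnergy_le_rayleigh_holds hHerm (Wᴴ *ᵥ v) hψ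
  rw [h1, star_mulVec, conjTranspose_conjTranspose, ← dotProduct_mulVec, mulVec_mulVec,
    mulVec_mulVec, hstar, hv, single_dotProduct, one_mul, mulVec_single_one, Matrix.col_apply, hW,
    xyTorus_trialEnergy L n hV hV' hVz hVy, Complex.neg_re,
    show (((n : ℂ) / 2) ^ 2 * (E.card : ℂ)) = ((((n : ℝ) / 2) ^ 2 * (E.card : ℝ) : ℝ) : ℂ) by
      push_cast; ring, Complex.ofReal_re] at h2
  -- (3) hence the edge sum of `g` is `≥ ½ S² |E|`
  have h3 : ((n : ℝ) / 2) ^ 2 / 2 * (E.card : ℝ) ≤ ∑ e ∈ E, g e := by linarith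
  -- (4) pairs versus edges
  have h4 := sum_pairs_eq_sum_edgeFinset L hL g
  have h5 := sum_pairs_eq_sum_edgeFinset (d := d) L hL (fun _ => (1 : ℝ))
  simp only [sum_const, card_univ, nsmul_eq_mul, mul_one, Fintype.card_fin] at h5
  rw [xyBondCorr_of_neZero]
  have hcard : (Fintype.card (TorusSite d L) : ℝ) = (L : ℝ) ^ d := by
    rw [Fintype.card_pi, prod_const, ZMod.card, card_univ, Fintype.card_fin]
    push_cast
    ring
  have hg' : ∀ (x : TorusSite d L) (i : Fin d),
      xyGroundCorr 0 L n x (x + Pi.single i 1) = g s(x, x + Pi.single i 1) := fun x i => rfl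
  simp_rw [hg']
  rw [h4]
  have hpos : (0 : ℝ) < (d : ℝ) * (L : ℝ) ^ d := by
    have : (0 : ℝ) < L := by exact_mod_cast (show 0 < L by omega)
    have : (0 : ℝ) < d := by exact_mod_cast (show 0 < d by omega)
    positivity
  rw [le_div_iff₀ hpos]
  -- `d L^d = c_L |E|`
  have h6 : (d : ℝ) * (L : ℝ) ^ d = (if L = 2 then (2 : ℝ) else 1) * (E.card : ℝ) := by
    rw [← hcard, mul_comm, h5]
  rw [h6]
  have hc : (0 : ℝ) ≤ (if L = 2 then (2 : ℝ) else 1) := by split_ifs <;> norm_num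
  calc ((n : ℝ) / 2) ^ 2 / 2 * ((if L = 2 then (2 : ℝ) else 1) * (E.card : ℝ))
      = (if L = 2 then (2 : ℝ) else 1) * (((n : ℝ) / 2) ^ 2 / 2 * (E.card : ℝ)) := by ring
    _ ≤ (if L = 2 then (2 : ℝ) else 1) * ∑ e ∈ E, g e := mul_le_mul_of_nonneg_left h3 hc

end BoundD

/-! ### (B) Kubo's inequality `|e₃| ≤ e₁` -/

section KuboB

/-- The tracial ground state of the XY torus on a general "XXZ-type" bond sum with real weights:
`Re ω(Σ_E (a b⁰ + b b¹ + c b²)) = a Σ_E G⁰ + b Σ_E G¹ + c Σ_E G²`. [folklore] -/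
theorem re_groundStateFunctional_bondSum (L : ℕ) [NeZero L] (n : ℕ) (a b c : ℝ) :
    ((xyTorus d L n).groundStateFunctional (∑ e ∈ (torusGraph d L).edgeFinset,
      Sym2.lift ⟨fun x y => (a : ℂ) • spinBond n 0 x y + (b : ℂ) • spinBond n 1 x y +
        (c : ℂ) • spinBond n 2 x y, fun x y => by simp only [spinBond_comm]⟩ e)).re =
      a * ∑ e ∈ (torusGraph d L).edgeFinset, Sym2.lift
          ⟨fun x y => xyGroundCorr 0 L n x y, fun x y => xyGroundCorr_symm 0 L n x y⟩ e +
      b * ∑ e ∈ (torusGraph d L).edgeFinset, Sym2.lift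
          ⟨fun x y => xyGroundCorr 1 L n x y, fun x y => xyGroundCorr_symm 1 L n x y⟩ e +
      c * ∑ e ∈ (torusGraph d L).edgeFinset, Sym2.lift
          ⟨fun x y => xyGroundCorr 2 L n x y, fun x y => xyGroundCorr_symm 2 L n x y⟩ e := by
  rw [map_sum, Complex.re_sum, mul_sum, mul_sum, mul_sum, ← sum_add_distrib, ← sum_add_distrib]
  refine sum_congr rfl fun e _ => ?_
  induction e using Sym2.ind with
  | h x y =>
    simp only [Sym2.lift_mk, map_add, LinearMap.map_smul, smul_eq_mul, Complex.add_re,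
      Complex.re_ofReal_mul, re_groundStateFunctional_spinBond]

/-- The XY torus Hamiltonian as a weighted bond sum (weights `-1, -1, 0`). [folklore] -/
theorem xyTorus_eq_bondSum (L : ℕ) [NeZero L] (n : ℕ) :
    xyTorus d L n = ∑ e ∈ (torusGraph d L).edgeFinset,
      Sym2.lift ⟨fun x y => ((-1 : ℝ) : ℂ) • spinBond n 0 x y + ((-1 : ℝ) : ℂ) • spinBond n 1 x y +
        ((0 : ℝ) : ℂ) • spinBond n 2 x y, fun x y => by simp only [spinBond_comm]⟩ e := by
  rw [show xyTorus d L n = ((-1 : ℝ) : ℂ) • ∑ e ∈ (torusGraph d L).edgeFinset,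
      Sym2.lift ⟨fun x y => spinBond n 0 x y + spinBond n 1 x y + ((0 : ℝ) : ℂ) • spinBond n 2 x y,
        fun x y => by simp only [spinBond_comm]⟩ e from rfl, smul_sum]
  refine sum_congr rfl fun e _ => ?_
  induction e using Sym2.ind with
  | h x y =>
    simp only [Sym2.lift_mk, smul_add, smul_smul, Complex.ofReal_neg, Complex.ofReal_one,
      Complex.ofReal_zero, mul_zero]

/-- The parity `ε(x) = Σᵢ xᵢ mod 2` of a site of the even torus `(ℤ/2kℤ)^d` (well defined since
`2 ∣ 2k`), through `ZMod.castHom`. [Dyson–Lieb–Simon 1978, §2 (the two sublattices)]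
[folklore] -/
theorem torusParity_add_single (k : ℕ) [NeZero (2 * k)] (x : TorusSite d (2 * k)) (i : Fin d) :
    (∑ j, ZMod.castHom (dvd_mul_right 2 k) (ZMod 2)
      ((x + (Pi.single i 1 : TorusSite d (2 * k))) j)) =
      (∑ j, ZMod.castHom (dvd_mul_right 2 k) (ZMod 2) (x j)) + 1 := by
  simp only [Pi.add_apply, map_add, sum_add_distrib, add_right_inj]
  rw [← map_sum, sum_pi_single' i (1 : ZMod (2 * k)) univ, if_pos (mem_univ i), map_one]

/-- **Discharge of (B)** `kubo_xy_bondCorr_abs_le`: `|e₃| ≤ e₁` on even tori (Kubo; KLS: "for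
otherwise the energy could be lowered by interchanging the 1 and 3 spin directions"). With
`E₀ = Re ω(H) = -Σ_E (G¹ + G²)`, the rotated Hamiltonians `H' = U₁ H U₁ᴴ = -Σ_E (b³ + b²)`
(`U₁ = ⨂ Vᴴ`, `V Sᶻ Vᴴ = Sˣ`) and `H'' = U₂ H' U₂ᴴ = -Σ_E (-b³ + b²)` (`U₂ = π`-rotation about
the `2`-axis on the odd sublattice of the bipartite even torus) have the same ground energy, and
the variational principle `E₀(B) ≤ Re ω(B)` gives `Σ_E G³ ≤ Σ_E G¹` and `-Σ_E G³ ≤ Σ_E G¹`;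
sums over site–direction pairs are `c_L` times sums over edges.
[Kennedy–Lieb–Shastry 1988, after eq. (4); Kubo 1988] [cite: KLS1988PRL, after eq. (4)]
[cite: Kubo1988PRL] -/
theorem kubo_xy_bondCorr_abs_le_holds : kubo_xy_bondCorr_abs_le := by
  intro d hd n k hk
  haveI : NeZero (2 * k) := ⟨by omega⟩
  have hL : 2 ≤ 2 * k := by omega
  set L := 2 * k with hLdef
  set E := (torusGraph d L).edgeFinset with hE
  set g : Fin 3 → Sym2 (TorusSite d L) → ℝ := fun α =>
    Sym2.lift ⟨fun x y => xyGroundCorr α L n x y, fun x y => xyGroundCorr_symm α L n x y⟩ with hg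
  set H := xyTorus d L n with hH
  have hHerm : H.IsHermitian := xyTorus_isHermitian d L n
  set ω := H.groundStateFunctional with hω
  -- the bond-sum operators `B(a,b,c) = Σ_E (a b⁰ + b b¹ + c b²)`
  set B : ℝ → ℝ → ℝ → Op (TorusSite d L) (n + 1) := fun a b c =>
    ∑ e ∈ E, Sym2.lift ⟨fun x y => (a : ℂ) • spinBond n 0 x y + (b : ℂ) • spinBond n 1 x y +
      (c : ℂ) • spinBond n 2 x y, fun x y => by simp only [spinBond_comm]⟩ e with hB
  have hωB : ∀ a b c : ℝ, (ω (B a b c)).re =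
      a * ∑ e ∈ E, g 0 e + b * ∑ e ∈ E, g 1 e + c * ∑ e ∈ E, g 2 e :=
    fun a b c => re_groundStateFunctional_bondSum L n a b c
  have hHB : H = B (-1) (-1) 0 := xyTorus_eq_bondSum L n
  -- (1) the ground energy
  have hE0 : H.groundEnergy = -(∑ e ∈ E, g 0 e) - ∑ e ∈ E, g 1 e := by
    have h := congrArg Complex.re (groundStateFunctional_hamiltonian hHerm)
    rw [Complex.ofReal_re] at h
    rw [← h, ← hω]
    conv_lhs => rw [show ω H = ω (B (-1) (-1) 0) by rw [← hHB]]
    rw [hωB]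
    ring
  -- (2) the single-site rotations
  obtain ⟨V, hV, hV', hVz, hVx, hVy⟩ := exists_unitary_conj_spinZ_eq_spinX n
  have hx : Vᴴ * spinX n * V = SpinOperators.spinZ n := by
    rw [← hVz, ← mul_assoc, ← mul_assoc, hV', one_mul, mul_assoc, hV', mul_one]
  have hy : Vᴴ * spinY n * V = spinY n := by
    conv_lhs => rw [← hVy]
    rw [← mul_assoc, ← mul_assoc, hV', one_mul, mul_assoc, hV', mul_one]
  set R := V * V with hR
  have hRR : R * Rᴴ = 1 := by
    rw [hR, conjTranspose_mul, mul_assoc, ← mul_assoc V Vᴴ, hV, one_mul, hV]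
  have hRR' : Rᴴ * R = 1 := by
    rw [hR, conjTranspose_mul, mul_assoc, ← mul_assoc Vᴴ V, hV', one_mul, hV']
  have hRz : R * SpinOperators.spinZ n * Rᴴ = -SpinOperators.spinZ n := by
    rw [hR, conjTranspose_mul, show V * V * SpinOperators.spinZ n * (Vᴴ * Vᴴ) =
      V * (V * SpinOperators.spinZ n * Vᴴ) * Vᴴ by simp only [mul_assoc], hVz, hVx]
  have hRy : R * spinY n * Rᴴ = spinY n := by
    rw [hR, conjTranspose_mul, show V * V * spinY n * (Vᴴ * Vᴴ) =
      V * (V * spinY n * Vᴴ) * Vᴴ by simp only [mul_assoc], hVy, hVy]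
  -- (3) `U₁ = ⨂ Vᴴ`: `H' = U₁ H U₁ᴴ = B 0 (-1) (-1)`
  set u₁ : TorusSite d L → Matrix (Fin (n + 1)) (Fin (n + 1)) ℂ := fun _ => Vᴴ with hu₁
  have hu₁a : ∀ z, u₁ z * (u₁ z)ᴴ = 1 := fun _ => by rw [hu₁, conjTranspose_conjTranspose, hV']
  have hu₁b : ∀ z, (u₁ z)ᴴ * u₁ z = 1 := fun _ => by rw [hu₁, conjTranspose_conjTranspose, hV]
  have hb0 : ∀ x y : TorusSite d L,
      productOp u₁ * spinBond n 0 x y * (productOp u₁)ᴴ = spinBond n 2 x y := by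
    intro x y
    rw [productOp_conj_spinBond hu₁a hu₁b, spinVec_zero, hu₁]
    simp only [conjTranspose_conjTranspose, hx]
    rfl
  have hb1 : ∀ x y : TorusSite d L,
      productOp u₁ * spinBond n 1 x y * (productOp u₁)ᴴ = spinBond n 1 x y := by
    intro x y
    rw [productOp_conj_spinBond hu₁a hu₁b, spinVec_one, hu₁]
    simp only [conjTranspose_conjTranspose, hy]
    rfl
  have hH' : productOp u₁ * H * (productOp u₁)ᴴ = B 0 (-1) (-1) := by
    rw [hHB, hB]
    simp only [mul_sum, sum_mul]
    refine sum_congr rfl fun e _ => ?_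
    induction e using Sym2.ind with
    | h x y =>
      simp only [Sym2.lift_mk, mul_add, add_mul, mul_smul_comm, smul_mul_assoc, hb0, hb1,
        Complex.ofReal_neg, Complex.ofReal_one, Complex.ofReal_zero, zero_smul, add_zero, zero_add]
      abel
  -- (4) `U₂ = R` on the odd sublattice: `H'' = U₂ H' U₂ᴴ = B 0 (-1) 1`
  set ε : TorusSite d L → ZMod 2 := fun x =>
    ∑ j, ZMod.castHom (dvd_mul_right 2 k) (ZMod 2) (x j) with hε
  set u₂ : TorusSite d L → Matrix (Fin (n + 1)) (Fin (n + 1)) ℂ :=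
    fun z => if ε z = 0 then 1 else R with hu₂
  have hu₂a : ∀ z, u₂ z * (u₂ z)ᴴ = 1 := by
    intro z; simp only [hu₂]; split_ifs
    · rw [conjTranspose_one, mul_one]
    · exact hRR
  have hu₂b : ∀ z, (u₂ z)ᴴ * u₂ z = 1 := by
    intro z; simp only [hu₂]; split_ifs
    · rw [conjTranspose_one, mul_one]
    · exact hRR'
  set sgn : TorusSite d L → ℂ := fun z => if ε z = 0 then 1 else -1 with hsgn
  have hu₂z : ∀ z, u₂ z * SpinOperators.spinZ n * (u₂ z)ᴴ = sgn z • SpinOperators.spinZ n := by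
    intro z; simp only [hu₂, hsgn]; split_ifs
    · rw [conjTranspose_one, mul_one, one_mul, one_smul]
    · rw [hRz, neg_one_smul]
  have hu₂y : ∀ z, u₂ z * spinY n * (u₂ z)ᴴ = spinY n := by
    intro z; simp only [hu₂]; split_ifs
    · rw [conjTranspose_one, mul_one, one_mul]
    · exact hRy
  -- adjacent sites have opposite parity, so `sgn x * sgn y = -1` on edges
  have hedge : ∀ e ∈ E, ∀ x y, e = s(x, y) → sgn x * sgn y = -1 := by
    intro e he x y hexy
    subst hexy
    rw [hE, SimpleGraph.mem_edgeFinset, SimpleGraph.mem_edgeSet, torusGraph_adj_iff] at he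
    have h01 : ∀ t : ZMod 2, t = 0 ∨ t = 1 := by decide
    have key : ∀ x' : TorusSite d L, ∀ i, sgn x' * sgn (x' + Pi.single i 1) = -1 := by
      intro x' i
      have hpar : ε (x' + Pi.single i 1) = ε x' + 1 := torusParity_add_single k x' i
      simp only [hsgn, hpar]
      rcases h01 (ε x') with h0 | h1
      · rw [if_pos h0, if_neg (by rw [h0]; decide), one_mul]
      · rw [if_neg (by rw [h1]; decide), if_pos (by rw [h1]; decide), mul_one]
    obtain ⟨-, ⟨i, rfl⟩ | ⟨i, rfl⟩⟩ := he
    · exact key x i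
    · rw [mul_comm]; exact key y i
  have hc2 : ∀ x y : TorusSite d L, sgn x * sgn y = -1 →
      productOp u₂ * spinBond n 2 x y * (productOp u₂)ᴴ = -spinBond n 2 x y := by
    intro x y hxy
    rw [productOp_conj_spinBond hu₂a hu₂b, spinVec_two, hu₂z, hu₂z, onSite_smul', onSite_smul',
      smul_mul_smul_comm, smul_mul_smul_comm, mul_comm (sgn y) (sgn x), hxy, spinBond]
    simp only [neg_smul, one_smul]
    rw [← neg_add, smul_neg]
    rfl
  have hc1 : ∀ x y : TorusSite d L,
      productOp u₂ * spinBond n 1 x y * (productOp u₂)ᴴ = spinBond n 1 x y := by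
    intro x y
    rw [productOp_conj_spinBond hu₂a hu₂b, spinVec_one, hu₂y, hu₂y, spinBond]
    rfl
  have hH'' : productOp u₂ * B 0 (-1) (-1) * (productOp u₂)ᴴ = B 0 (-1) 1 := by
    rw [hB]
    simp only [mul_sum, sum_mul]
    refine sum_congr rfl fun e he => ?_
    induction e using Sym2.ind with
    | h x y =>
      have hs := hedge _ he x y rfl
      simp only [Sym2.lift_mk, mul_add, add_mul, Complex.ofReal_neg, Complex.ofReal_one,
        Complex.ofReal_zero, zero_smul, zero_add, neg_smul, one_smul, mul_neg, neg_mul, hc1,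
        hc2 x y hs, neg_neg]
  -- (5) equal ground energies and the variational principle
  have hU₁ : productOp u₁ ∈ Matrix.unitaryGroup (TensorIndex (TorusSite d L) (n + 1)) ℂ :=
    Matrix.mem_unitaryGroup_iff.2 (productOp_mul_conjTranspose hu₁a)
  have hU₂ : productOp u₂ ∈ Matrix.unitaryGroup (TensorIndex (TorusSite d L) (n + 1)) ℂ :=
    Matrix.mem_unitaryGroup_iff.2 (productOp_mul_conjTranspose hu₂a)
  have hE0' : (B 0 (-1) (-1)).groundEnergy = H.groundEnergy := by
    rw [← hH', Matrix.groundEnergy_unitary_conj hU₁]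
  have hE0'' : (B 0 (-1) 1).groundEnergy = H.groundEnergy := by
    rw [← hH'', Matrix.groundEnergy_unitary_conj hU₂, hE0']
  have hHerm' : (B 0 (-1) (-1)).IsHermitian := by
    rw [← hH']; exact isHermitian_mul_mul_conjTranspose _ hHerm
  have hHerm'' : (B 0 (-1) 1).IsHermitian := by
    rw [← hH'']; exact isHermitian_mul_mul_conjTranspose _ hHerm'
  have hv' := groundEnergy_le_groundStateFunctional_re hHerm hHerm'
  have hv'' := groundEnergy_le_groundStateFunctional_re hHerm hHerm''
  rw [hE0', hE0, ← hω, hωB] at hv'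
  rw [hE0'', hE0, ← hω, hωB] at hv''
  -- (6) `|Σ_E G²| ≤ Σ_E G⁰`, then pairs versus edges
  have habs : |∑ e ∈ E, g 2 e| ≤ ∑ e ∈ E, g 0 e := by
    rw [abs_le]; constructor <;> linarith
  have h0 := sum_pairs_eq_sum_edgeFinset L hL (g 0)
  have h2 := sum_pairs_eq_sum_edgeFinset L hL (g 2)
  have hg' : ∀ (α : Fin 3) (x : TorusSite d L) (i : Fin d),
      xyGroundCorr α L n x (x + Pi.single i 1) = g α s(x, x + Pi.single i 1) := fun α x i => rfl
  rw [xyBondCorr_of_neZero, xyBondCorr_of_neZero]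
  simp_rw [hg']
  rw [h0, h2, abs_div, abs_mul, abs_of_nonneg (show (0 : ℝ) ≤ (if L = 2 then (2 : ℝ) else 1) by
    split_ifs <;> norm_num), abs_of_nonneg (show (0 : ℝ) ≤ (d : ℝ) * (L : ℝ) ^ d by positivity)]
  refine div_le_div_of_nonneg_right (mul_le_mul_of_nonneg_left habs ?_) (by positivity)
  split_ifs <;> norm_num

end KuboB

end Hubbard

end Literature.MathematicalPhysics.QuantumLattice
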